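import Mathlib.Analysis.Normed.Algebra.MatrixExponential
import Mathlib.Analysis.Matrix.Normed
import Mathlib.LinearAlgebra.UnitaryGroup
import Mathlib.Algebra.Lie.Subalgebra
import Mathlib.Algebra.Lie.OfAssociative
import Mathlib.Algebra.Star.SelfAdjoint
import Mathlib.Algebra.Star.Unitary
import Mathlib.Algebra.Lie.Matrix
import Mathlib.Topology.Algebra.Star
import HarnessLib

-- provenance: harness21/H21/H21/Prelude/AutomorphicL/RealMatrixGroups.lean @ 4e9970a (interim HEAD d8f2665); M5 mechanical rewrite
/-!
# Linear real groups `G ≤ GL N A` over a real Banach `*`-algebra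

Trunk: AutomorphicL (prelude, item I8 `RealMatrixGroups`; notion `archimedean_gK_module`).

The archimedean component of an adelic group is modelled, following the outline (design D2), as a
*linear real group*: a closed subgroup `G ≤ GL N A` of invertible matrices over a real Banach
`*`-algebra `A` (typically `A = ℝ`, `ℂ`, or the mixed space `K_∞ = ℝ^{r₁} × ℂ^{r₂}` of a number
field), together with a real Lie subalgebra `𝔤 ≤ Matrix N N A` such that `exp (t X) ∈ G` for
`X ∈ 𝔤`, `𝔤` is `Ad G`-stable and `G` is stable under the conjugate transpose `star`.
The maximal compact subgroup is `K := G ∩ U(N, A)` and its Lie algebra `𝔨 := 𝔤 ∩ 𝔲(N, A)`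
(skew-hermitian matrices).

## Main definitions

* `Literature.NumberTheory.Automorphic.expGL X : GL N A` — the matrix exponential as an invertible
  matrix (`Matrix.isUnit_exp`), with `expGL_zero`, `expGL_add_of_commute`, `expGL_neg`,
  `expGL_smul_add_smul` and the one-parameter subgroup `oneParamGL X : Multiplicative ℝ →* GL N A`.
* `Literature.NumberTheory.Automorphic.unitarySubgroupGL A N : Subgroup (GL N A)` — the unitary
  group `U(N, A)` as a subgroup of `GL N A`. This IS Mathlib's `unitarySubgroup (GL N A)`
  (unitary elements of the star monoid of units); we only fix the name and give the matrix-level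
  membership lemmas
  `mem_unitarySubgroupGL_iff` (`star ↑g * ↑g = 1`) and
  `mem_unitarySubgroupGL_iff_coe_mem_unitaryGroup` (comparison with `Matrix.unitaryGroup N A`,
  which is a submonoid of `Matrix N N A`, not a subgroup of `GL N A`).
* `Literature.NumberTheory.Automorphic.skewHermitianLie A N : LieSubalgebra ℝ (Matrix N N A)` —
  skew-hermitian matrices `𝔲(N, A)`, carrier `skewAdjoint (Matrix N N A)`.
* `Literature.NumberTheory.Automorphic.RealMatrixGroup A N` — the structure described above, with
  `RealMatrixGroup.gl` (the full group), `.maximalCompact`, `.compactLie`, `.expMem`, `.expK`,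
  `.Ad`.
* `Literature.NumberTheory.Automorphic.IsStarFormallyReal A` — the PREDICATE (a hypothesis on the
  coefficient algebra `A`, not a named fact) `∑ star xᵢ * xᵢ = 0 → xᵢ = 0`; for a finite-dimensional
  commutative real algebra with `ℝ`-linear involution it singles out `A ≅ ℝ^r × ℂ^s` with the
  standard involutions, which is what makes `U(N, A)` compact (it fails for `ℂ` with the trivial
  involution, where `U(2)` becomes the non-compact `O(2, ℂ)`). Instances (`ℝ`, `ℂ`, `RCLike`
  fields, finite products, `ℝ^{r₁} × ℂ^{r₂}`) and the counterexample `not_forall_isStarFormallyReal`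
  are proved in `RealMatrixGroupsProofs`.
* `Literature.NumberTheory.Automorphic.RealMatrixGroup.HasCartanDecomposition G` — the PREDICATE
  (a hypothesis on `G`, not a named fact) "global Cartan decomposition `G = K · exp(𝔭)`", an axiom
  of a reductive Lie group in Knapp, *Lie Groups Beyond an Introduction*, VII.§2, property (iv),
  p. 446, and in Knapp–Vogan 1995, Def. 4.29 (iii), p. 244; a theorem for semisimple `G`
  (Knapp, Thm. 6.31(c)) and for `GL_n` over `ℝ`, `ℂ`, `K_∞` (proved in `ArchGroupGLCartan`); false
  for `GL N A` with the zero Lie algebra and for `GL₂(ℤ)`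
  (`RealMatrixGroup.not_forall_hasCartanDecomposition` and
  `RealMatrixGroup.exists_carrier_forall_not_hasCartanDecomposition` in
  `RealMatrixGroupsCartanCounterexample`).

## Named facts (all three discharged in the sibling file `RealMatrixGroupsProofs`)

* `isCompact_unitarySubgroupGL`, `RealMatrixGroup.isCompact_maximalCompact` — `K` is compact
  (Knapp, I.§17, (1.135)–(1.137), pp. 111–113: `SO(n)`, `SU(n)` and the related `O(n)`, `U(n)`
  are compact by the Heine–Borel theorem);
  `isCompact_unitarySubgroupGL_holds`, `RealMatrixGroup.isCompact_maximalCompact_holds`.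
* `RealMatrixGroup.isMaximalCompact_maximalCompact` — `K` is a maximal compact subgroup
  (Cartan–Malcev–Iwasawa; Knapp, Thm. 6.31(g), p. 362, and Prop. 7.19(a), p. 448);
  `RealMatrixGroup.isMaximalCompact_maximalCompact_holds`.

`IsStarFormallyReal A` and `RealMatrixGroup.HasCartanDecomposition G` are the *hypotheses* of these
facts — parametrised predicates with explicit binders, i.e. definitions; no `_holds` discharge is
meaningful for them (their closures over all `A`, resp. all `G`, are refuted by
`not_forall_isStarFormallyReal` in `RealMatrixGroupsProofs` and by
`RealMatrixGroup.not_forall_hasCartanDecomposition` in `RealMatrixGroupsCartanCounterexample`).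

## Design notes

* (H1) The Lie bracket on `Matrix N N A` is the commutator: we use Mathlib's idiom
  `attribute [local instance 100] LieRing.ofAssociativeRing`.
* (H3) No global normed instance on matrices is used; `Matrix.exp_*` lemmas are topology-only.
* (H8) `[ContinuousStar A]` is a hypothesis of `expGL_mem_unitarySubgroupGL` (and of `expK`,
  which uses it) only. Similarly `[StarModule ℝ A]` (compatibility of `star` with real scalars,
  needed for `𝔲(N, A)` to be a *real* subspace) is a hypothesis of `skewHermitianLie`,
  `compactLie`, `expK` and the compactness statements only, not of `RealMatrixGroup`.
* `RealMatrixGroup.Ad` is defined directly (conjugation by a unit), because Mathlib's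
  `Matrix.lieConj` is `A`-linear (an equivalence of Lie algebras over the coefficient ring `A`),
  whereas we need the `ℝ`-linear restriction to `𝔤`; `Ad_apply_coe` records the formula.
* Mathlib's `skewAdjointMatricesLieSubalgebra J` is the Lie algebra of matrices skew-adjoint with
  respect to a bilinear form `J` (`Jᵀ Aᵀ J⁻¹ = -A`-type condition), a different notion from the
  `star`-skew-hermitian matrices used here.

## References

* A. W. Knapp, *Lie Groups Beyond an Introduction*, 2nd ed., Progress in Mathematics 140,
  Birkhäuser 2002 (digital 2nd ed. 2023, same numbering and pagination): Introduction §2;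
  I.§10; I.§17, (1.135)–(1.137), pp. 111–113 and Prop. 1.143, pp. 116–117 (polar decomposition);
  VI.§2–3,
  (6.23)–(6.24) and Thm. 6.31, p. 362; VII.§2, pp. 446–448 (definition of a reductive Lie group,
  properties (i)–(vi); Prop. 7.19). [Knapp2002]
* A. W. Knapp, D. A. Vogan, Jr., *Cohomological Induction and Unitary Representations*, Princeton
  Mathematical Series 45, Princeton University Press 1995, IV.§3, Def. 4.29, p. 244.
  [KnappVogan1995]
* A. Borel, H. Jacquet, *Automorphic forms and automorphic representations*, Corvallis 1979, §1.
-/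

-- Mathlib idiom (Mathlib/Algebra/Lie/OfAssociative.lean); needed to mention Lie subalgebras of matrix algebras
attribute [local instance 100] LieRing.ofAssociativeRing

open scoped MatrixGroups Matrix

open NormedSpace -- for `exp`

noncomputable section

namespace Literature.NumberTheory.Automorphic

variable (A : Type*) [NormedCommRing A] (N : Type*) [Fintype N] [DecidableEq N]

/-! ## The exponential into `GL N A` -/

section Exp

variable {A N} [NormedAlgebra ℚ A] [CompleteSpace A]

/-- The matrix exponential `exp X` of `X : Matrix N N A`, as an element of `GL N A`
(it is invertible with inverse `exp (-X)`; `Matrix.isUnit_exp`). Knapp, *Lie Groups Beyond an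
Introduction*, 0.§2. [folklore] -/
def expGL (X : Matrix N N A) : GL N A := (Matrix.isUnit_exp X).unit

/-- The underlying matrix of `expGL X` is `exp X`. Knapp, 0.§2. [folklore] -/
@[simp]
theorem coe_expGL (X : Matrix N N A) : (expGL X : Matrix N N A) = exp X := rfl

/-- `exp 0 = 1` in `GL N A`. Knapp, 0.§2. [folklore] -/
@[simp]
theorem expGL_zero : expGL (0 : Matrix N N A) = 1 := by
  ext : 1
  simp

/-- `exp (X + Y) = exp X * exp Y` for commuting matrices (`Matrix.exp_add_of_commute`).
Knapp, 0.§2, Prop. 0.11(c). [folklore] -/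
theorem expGL_add_of_commute (X Y : Matrix N N A) (h : Commute X Y) :
    expGL (X + Y) = expGL X * expGL Y := by
  ext : 1
  simp [Matrix.exp_add_of_commute X Y h]

/-- `exp (-X) = (exp X)⁻¹` in `GL N A` (`Matrix.exp_neg`). Knapp, 0.§2, Prop. 0.11(c). [folklore] -/
theorem expGL_neg (X : Matrix N N A) : expGL (-X) = (expGL X)⁻¹ := by
  ext : 1
  simp [Matrix.exp_neg, Matrix.coe_units_inv]

variable [NormedAlgebra ℝ A]

/-- `exp (s X + t X) = exp (s X) * exp (t X)`: `t ↦ exp (t X)` is a one-parameter subgroup.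
Knapp, 0.§2, Prop. 0.11(c). [folklore] -/
theorem expGL_smul_add_smul (s t : ℝ) (X : Matrix N N A) :
    expGL (s • X + t • X) = expGL (s • X) * expGL (t • X) :=
  expGL_add_of_commute _ _ (((Commute.refl X).smul_left s).smul_right t)

/-- `exp ((s + t) X) = exp (s X) * exp (t X)`. Knapp, 0.§2, Prop. 0.11(c). [folklore] -/
theorem expGL_add_smul (s t : ℝ) (X : Matrix N N A) :
    expGL ((s + t) • X) = expGL (s • X) * expGL (t • X) := by
  rw [add_smul, expGL_smul_add_smul]

/-- The one-parameter subgroup `t ↦ exp (t X) : ℝ → GL N A` of `X : Matrix N N A`, as a monoid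
homomorphism from `Multiplicative ℝ`. Knapp, 0.§2 and I.§10. [folklore] -/
def oneParamGL (X : Matrix N N A) : Multiplicative ℝ →* GL N A where
  toFun t := expGL (t.toAdd • X)
  map_one' := by simp
  map_mul' s t := by simp [expGL_add_smul]

/-- `oneParamGL X t = exp (t X)`. Knapp, 0.§2. [folklore] -/
@[simp]
theorem oneParamGL_apply (X : Matrix N N A) (t : Multiplicative ℝ) :
    oneParamGL X t = expGL (t.toAdd • X) := rfl

end Exp

/-! ## The unitary subgroup `U(N, A) ≤ GL N A` and its Lie algebra -/

section Unitary

variable [StarRing A]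

/-- The unitary group `U(N, A) = {g ∈ GL N A | star g * g = 1}` (`star` = conjugate transpose)
as a subgroup of `GL N A`. This is Mathlib's `unitarySubgroup (GL N A)`; for `A = ℝ` it is
`O(N)`, for `A = ℂ` it is `U(N)`. Knapp, I.§1 and I.§17. [folklore] -/
abbrev unitarySubgroupGL : Subgroup (GL N A) := unitarySubgroup (GL N A)

variable {A N}

/-- Membership in `U(N, A)`: `star ↑g * ↑g = 1` as matrices. Knapp, I.§1. [folklore] -/
theorem mem_unitarySubgroupGL_iff (g : GL N A) :
    g ∈ unitarySubgroupGL A N ↔ star (g : Matrix N N A) * g = 1 := by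
  rw [mem_unitarySubgroup_iff, (Group.isUnit g).mem_unitary_iff_star_mul_self, Units.ext_iff,
    Units.val_mul, Units.coe_star, Units.val_one]

/-- `g ∈ U(N, A) ≤ GL N A` iff the underlying matrix lies in Mathlib's `Matrix.unitaryGroup N A`.
This is not a duplicate of Mathlib: `Matrix.unitaryGroup N A` is a *submonoid of `Matrix N N A`*
(whose `Matrix.UnitaryGroup.toGL` lands in `LinearMap.GeneralLinearGroup`), whereas we need a
*subgroup of `GL N A`* to intersect with `G ≤ GL N A`. Knapp, I.§1. [folklore] -/
theorem mem_unitarySubgroupGL_iff_coe_mem_unitaryGroup (g : GL N A) :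
    g ∈ unitarySubgroupGL A N ↔ (g : Matrix N N A) ∈ Matrix.unitaryGroup N A := by
  rw [mem_unitarySubgroupGL_iff, Matrix.mem_unitaryGroup_iff']

/-- `star g ∈ U(N, A)` for `g ∈ U(N, A)`. Knapp, I.§1. [folklore] -/
theorem star_mem_unitarySubgroupGL {g : GL N A} (hg : g ∈ unitarySubgroupGL A N) :
    star g ∈ unitarySubgroupGL A N :=
  Unitary.star_mem hg

/-- `U(N, A)` is closed in `GL N A`. Knapp, I.§1. [folklore] -/
theorem isClosed_unitarySubgroupGL [ContinuousStar A] :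
    IsClosed (unitarySubgroupGL A N : Set (GL N A)) := by
  have : (unitarySubgroupGL A N : Set (GL N A)) =
      {g : GL N A | star (g : Matrix N N A) * g = 1} := by
    ext g; exact mem_unitarySubgroupGL_iff g
  rw [this]
  exact isClosed_eq ((Units.continuous_val.star).mul Units.continuous_val) continuous_const

section Lie

variable (A N) [NormedAlgebra ℝ A] [StarModule ℝ A]

/-- The Lie algebra `𝔲(N, A)` of skew-hermitian matrices `star X = -X`, a real Lie subalgebra of
`Matrix N N A` (carrier `skewAdjoint (Matrix N N A)`); it is the Lie algebra of `U(N, A)`.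
Not Mathlib's `skewAdjointMatricesLieSubalgebra J` (skew-adjointness for a bilinear form `J`).
`[StarModule ℝ A]` (`star (t • a) = t • star a`) is what makes it a *real* subspace.
Knapp, I.§1, Example (2) and I.§17. [folklore] -/
def skewHermitianLie : LieSubalgebra ℝ (Matrix N N A) where
  carrier := skewAdjoint (Matrix N N A)
  add_mem' := (skewAdjoint (Matrix N N A)).add_mem
  zero_mem' := (skewAdjoint (Matrix N N A)).zero_mem
  smul_mem' t X hX := skewAdjoint.smul_mem t hX
  lie_mem' {X Y} hX hY := by
    have hX' : star X = -X := skewAdjoint.mem_iff.mp hX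
    have hY' : star Y = -Y := skewAdjoint.mem_iff.mp hY
    change ⁅X, Y⁆ ∈ skewAdjoint (Matrix N N A)
    rw [skewAdjoint.mem_iff, Ring.lie_def, star_sub, star_mul, star_mul, hX', hY']
    noncomm_ring

variable {A N}

/-- Membership in `𝔲(N, A)`: `star X = -X`. Knapp, I.§1. [folklore] -/
@[simp]
theorem mem_skewHermitianLie_iff (X : Matrix N N A) :
    X ∈ skewHermitianLie A N ↔ star X = -X :=
  skewAdjoint.mem_iff

/-- The carrier of `𝔲(N, A)` is `skewAdjoint (Matrix N N A)`. Knapp, I.§1. [folklore] -/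
theorem coe_skewHermitianLie :
    (skewHermitianLie A N : Set (Matrix N N A)) = skewAdjoint (Matrix N N A) := rfl

end Lie

section ExpUnitary

variable [NormedAlgebra ℚ A] [CompleteSpace A]

/-- For a skew-hermitian matrix `X` (`star X = -X`), `exp X` is unitary:
`star (exp X) * exp X = exp (-X) * exp X = 1` (`Matrix.exp_conjTranspose`, `Matrix.exp_neg`).
`[ContinuousStar A]` is needed for `star` to commute with the exponential series.
Knapp, I.§1, Introduction (closed linear groups), and I.§17. [folklore] -/
theorem expGL_mem_unitarySubgroupGL [ContinuousStar A] {X : Matrix N N A}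
    (hX : X ∈ skewAdjoint (Matrix N N A)) : expGL X ∈ unitarySubgroupGL A N := by
  rw [mem_unitarySubgroupGL_iff, coe_expGL, Matrix.star_eq_conjTranspose,
    ← Matrix.exp_conjTranspose, ← Matrix.star_eq_conjTranspose, skewAdjoint.mem_iff.mp hX,
    ← Matrix.exp_add_of_commute _ _ (Commute.neg_left (Commute.refl X)), neg_add_cancel, exp_zero]

end ExpUnitary

/-- **Star-formal reality of the coefficient algebra** — a DEFINITION (parametrised predicate on
`A`; it is the standing hypothesis `hA` of the named facts `isCompact_unitarySubgroupGL`,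
`RealMatrixGroup.isCompact_maximalCompact` and `RealMatrixGroup.isMaximalCompact_maximalCompact`,
not itself a named fact: there is no `IsStarFormallyReal_holds`, and the closure over all `A` is
false — `not_forall_isStarFormallyReal` in `RealMatrixGroupsProofs`, `ℂ` with the trivial
involution, `1·1 + i·i = 0`).
A `*`-ring `A` is *star-formally real* if `∑ᵢ star xᵢ * xᵢ = 0` forces all `xᵢ = 0`. For a
finite-dimensional commutative real algebra with `ℝ`-linear involution this holds iff
`A ≅ ℝ^r × ℂ^s` with the standard involutions (it kills nilpotents, factor-permuting involutions
and the trivial involution on `ℂ`); it is what makes `U(N, A)` compact — Knapp, *Lie Groups Beyond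
an Introduction*, I.§17, (1.135)–(1.137), pp. 111–113 (the groups `g* g = 1` are compact by
Heine–Borel, "their entries being bounded in absolute value by 1") and VII.§2, Example 2, p. 447
(`K = G ∩ U(n)` is compact for a closed linear group `G` stable under conjugate transpose).
Proved instances: `ℝ`, `ℂ`, every `RCLike` field, finite products and `ℝ^{r₁} × ℂ^{r₂}`
(`RealMatrixGroupsProofs`), `mixedSpace K` (`AdelicGLnGlue`).
(Mathlib's `IsFormallyReal` is the star-free notion `∑ xᵢ² = 0 → xᵢ = 0`, which fails for `ℂ`.)
The binder `(A : Type*)` is explicit: this is a predicate, used as `(hA : IsStarFormallyReal A)`.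
[folklore] -/
def IsStarFormallyReal (A : Type*) [NormedCommRing A] [StarRing A] : Prop :=
  ∀ (n : ℕ) (x : Fin n → A), ∑ i, star (x i) * x i = 0 → ∀ i, x i = 0

/-- `U(N, A)` is compact when `A` is a finite-dimensional star-formally-real commutative real
`*`-algebra (then `A ≅ ℝ^r × ℂ^s` and `U(N, A) ≅ O(N)^r × U(N)^s`). Knapp, I.§1 (compactness of
`O(n)`, `U(n)`), Prop. 1.143 context. [cite: Knapp2002, I.§17 and Prop. 1.143 (compactness of O(n) and U(n))] -/
def isCompact_unitarySubgroupGL : Prop :=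
  ∀ [NormedAlgebra ℝ A] [FiniteDimensional ℝ A] [StarModule ℝ A] (hA : IsStarFormallyReal A),
    IsCompact (unitarySubgroupGL A N : Set (GL N A))

end Unitary

/-! ## Linear real groups -/

section RealMatrixGroup

variable [NormedAlgebra ℝ A] [NormedAlgebra ℚ A] [CompleteSpace A] [StarRing A]

/-- A *linear real group* `G ≤ GL N A` over the real Banach `*`-algebra `A`: a closed subgroup
`carrier` of `GL N A` together with a real Lie subalgebra `lie ≤ Matrix N N A` (its Lie algebra
`𝔤`) such that the one-parameter groups `t ↦ exp (t X)`, `X ∈ 𝔤`, lie in `G`, `𝔤` is stable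
under `Ad g : X ↦ g X g⁻¹` for `g ∈ G`, and `G` is stable under the conjugate transpose `star`
(the Cartan involution is then `g ↦ (star g)⁻¹`). Examples: `GL N A` itself
(`RealMatrixGroup.gl`), `SL`, `O(p, q)`, `Sp`, and `GL n (K ⊗ ℝ)` for a number field `K`.
Knapp, *Lie Groups Beyond an Introduction*, Introduction ("closed linear groups"), I.§10 and
VII.§2, Example 5. [folklore] -/
structure RealMatrixGroup where
  /-- The underlying closed subgroup `G ≤ GL N A`. -/
  carrier : Subgroup (GL N A)
  /-- The Lie algebra `𝔤 ≤ Matrix N N A` of `G`, a real Lie subalgebra for the commutator. -/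
  lie : LieSubalgebra ℝ (Matrix N N A)
  /-- One-parameter subgroups generated by `𝔤` lie in `G`. -/
  expGL_smul_mem : ∀ X ∈ lie, ∀ t : ℝ, expGL (t • X) ∈ carrier
  /-- `𝔤` is `Ad G`-stable. -/
  conj_mem_lie : ∀ g ∈ carrier, ∀ X ∈ lie, (g : Matrix N N A) * X * ((g⁻¹ : GL N A) : Matrix N N A) ∈ lie
  /-- `G` is stable under the conjugate transpose. -/
  star_mem : ∀ g ∈ carrier, star g ∈ carrier
  /-- `G` is closed in `GL N A`. -/
  isClosed : IsClosed (carrier : Set (GL N A))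

namespace RealMatrixGroup

/-- The full linear group `GL N A` as a linear real group, with Lie algebra all of
`Matrix N N A = 𝔤𝔩(N, A)`. Knapp, I.§1, Example (1). [folklore] -/
protected def gl : RealMatrixGroup A N where
  carrier := ⊤
  lie := ⊤
  expGL_smul_mem := by simp
  conj_mem_lie := by simp
  star_mem := by simp
  isClosed := by simp

/-- The carrier of `RealMatrixGroup.gl` is all of `GL N A`. Knapp, I.§1. [folklore] -/
@[simp]
theorem gl_carrier : (RealMatrixGroup.gl A N).carrier = ⊤ := rfl

/-- The Lie algebra of `RealMatrixGroup.gl` is all of `Matrix N N A`. Knapp, I.§1. [folklore] -/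
@[simp]
theorem gl_lie : (RealMatrixGroup.gl A N).lie = ⊤ := rfl

variable {A N} (G : RealMatrixGroup A N)

/-- The subgroup `K := G ∩ U(N, A)` of `G`; it is a maximal compact subgroup of `G`
(`isMaximalCompact_maximalCompact`). For `G = GL n ℝ` it is `O(n)`, for `GL n ℂ` it is `U(n)`.
Knapp, I.§1 and VI.§2; Borel–Jacquet §1.1 (`K_∞`). [folklore] -/
def maximalCompact : Subgroup (GL N A) := G.carrier ⊓ unitarySubgroupGL A N

/-- Membership in `K = G ∩ U(N, A)`. Knapp, I.§1. [folklore] -/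
theorem mem_maximalCompact_iff (g : GL N A) :
    g ∈ G.maximalCompact ↔ g ∈ G.carrier ∧ star (g : Matrix N N A) * g = 1 := by
  rw [maximalCompact, Subgroup.mem_inf, mem_unitarySubgroupGL_iff]

/-- `K ≤ G`. Knapp, I.§1. [folklore] -/
theorem maximalCompact_le_carrier : G.maximalCompact ≤ G.carrier := inf_le_left

/-- `K = GL N A ∩ U(N, A) = U(N, A)` for the full linear group. Knapp, I.§1. [folklore] -/
@[simp]
theorem maximalCompact_gl : (RealMatrixGroup.gl A N).maximalCompact = unitarySubgroupGL A N :=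
  top_inf_eq _

/-- `K` is closed in `GL N A`. Knapp, I.§1. [folklore] -/
theorem isClosed_maximalCompact [ContinuousStar A] :
    IsClosed (G.maximalCompact : Set (GL N A)) :=
  G.isClosed.inter isClosed_unitarySubgroupGL

/-- `K = G ∩ U(N, A)` is compact whenever `U(N, A)` is (`G` is closed). Knapp, I.§1. [folklore] -/
theorem isCompact_maximalCompact_of_isCompact
    (hU : IsCompact (unitarySubgroupGL A N : Set (GL N A))) :
    IsCompact (G.maximalCompact : Set (GL N A)) :=
  hU.inter_left G.isClosed

/-- The exponential `𝔤 → G`, `X ↦ exp X`. Knapp, I.§10, Prop. 1.87. [folklore] -/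
def expMem (X : G.lie) : G.carrier :=
  ⟨expGL (X : Matrix N N A), by simpa using G.expGL_smul_mem X X.2 1⟩

/-- `expMem X = exp X` in `GL N A`. Knapp, I.§10. [folklore] -/
@[simp]
theorem coe_expMem (X : G.lie) : (G.expMem X : GL N A) = expGL (X : Matrix N N A) := rfl

/-- The adjoint action `Ad g : 𝔤 → 𝔤`, `X ↦ g X g⁻¹`, of `g ∈ G` on the Lie algebra, as a
morphism of real Lie algebras. (Mathlib's `Matrix.lieConj` is the `A`-linear conjugation
equivalence of all of `Matrix N N A`; here we need its `ℝ`-linear restriction to `𝔤`.)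
Knapp, I.§10, (1.83) and Prop. 1.89. [folklore] -/
def Ad (g : G.carrier) : G.lie →ₗ⁅ℝ⁆ G.lie where
  toFun X := ⟨((g : GL N A) : Matrix N N A) * X * (((g : GL N A)⁻¹ : GL N A) : Matrix N N A),
    G.conj_mem_lie _ g.2 _ X.2⟩
  map_add' X Y := by
    ext : 1
    simp [mul_add, add_mul]
  map_smul' t X := by
    ext : 1
    simp
  map_lie' {X Y} := by
    ext : 1
    simp only [LieSubalgebra.coe_bracket, Ring.lie_def]
    simp [mul_sub, sub_mul, mul_assoc]

/-- `Ad g X = g X g⁻¹` as matrices. Knapp, I.§10, (1.83). [folklore] -/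
@[simp]
theorem Ad_apply_coe (g : G.carrier) (X : G.lie) :
    (G.Ad g X : Matrix N N A) =
      ((g : GL N A) : Matrix N N A) * X * (((g : GL N A)⁻¹ : GL N A) : Matrix N N A) := rfl

section Compact

variable [StarModule ℝ A]

/-- The Lie algebra `𝔨 := 𝔤 ∩ 𝔲(N, A)` of `K` (skew-hermitian elements of `𝔤`).
Knapp, VI.§2, (6.24). [folklore] -/
def compactLie : LieSubalgebra ℝ (Matrix N N A) := G.lie ⊓ skewHermitianLie A N

/-- Membership in `𝔨 = 𝔤 ∩ 𝔲(N, A)`. Knapp, VI.§2. [folklore] -/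
theorem mem_compactLie_iff (X : Matrix N N A) :
    X ∈ G.compactLie ↔ X ∈ G.lie ∧ star X = -X := by
  rw [compactLie, LieSubalgebra.mem_inf, mem_skewHermitianLie_iff]

/-- `𝔨 ≤ 𝔤`. Knapp, VI.§2. [folklore] -/
theorem compactLie_le_lie : G.compactLie ≤ G.lie := inf_le_left

/-- The exponential `𝔨 → K`, `X ↦ exp X` (a skew-hermitian `X ∈ 𝔤` exponentiates into
`G ∩ U(N, A)`). Knapp, I.§10, Prop. 1.87 and VI.§2. [folklore] -/
def expK [ContinuousStar A] (X : G.compactLie) : G.maximalCompact :=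
  ⟨expGL (X : Matrix N N A),
    ⟨by simpa using G.expGL_smul_mem X (G.compactLie_le_lie X.2) 1,
      expGL_mem_unitarySubgroupGL ((G.mem_compactLie_iff X).mp X.2).2⟩⟩

/-- `expK X = exp X` in `GL N A`. Knapp, I.§10. [folklore] -/
@[simp]
theorem coe_expK [ContinuousStar A] (X : G.compactLie) :
    (G.expK X : GL N A) = expGL (X : Matrix N N A) := rfl

/-- **The global Cartan decomposition `G = K · exp 𝔭`** — a DEFINITION (parametrised predicate on
`G`; it is the hypothesis `hG` of the named fact `isMaximalCompact_maximalCompact` and of the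
regularity conditions downstream, not itself a named fact: there is no
`HasCartanDecomposition_holds`, and the closure over all `G` is false —
`RealMatrixGroup.not_forall_hasCartanDecomposition` in `RealMatrixGroupsCartanCounterexample`:
`GL N A` with the zero Lie algebra is a `RealMatrixGroup`, but the scalar `2` is not unitary; there
also `GL₂(ℤ) ≤ GL₂(ℝ)`, whose every admissible Lie algebra is `0`, has no such decomposition).
`G.HasCartanDecomposition` says that every `g ∈ G` is `k * exp X` with `k ∈ K = G ∩ U(N, A)` and
`X ∈ 𝔤` hermitian (`𝔭 := 𝔤 ∩ {star X = X}`). Knapp takes this as an AXIOM of a reductive Lie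
group: *Lie Groups Beyond an Introduction* (2002), VII.§2, property (iv) of the definition, p. 446
("the global Cartan decomposition", p. 447; stated there in the stronger form "multiplication
`K × exp 𝔭₀ → G` is a diffeomorphism onto", of which only surjectivity is recorded here), as do
Knapp–Vogan, *Cohomological Induction and Unitary Representations* (1995), Def. 4.29 (iii), p. 244.
It is a THEOREM for semisimple `G` (Knapp 2002, Thm. 6.31(c), p. 362) and, as the polar
decomposition, for closed linear groups stable under conjugate transpose and cut out by polynomial
equations (Prop. 1.143, pp. 116–117) — in particular for `GL_n(ℝ)`, `GL_n(ℂ)`, `GL_n(K_∞)`: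
`RealMatrixGroup.hasCartanDecomposition_gl`, `hasCartanDecomposition_archGroupGL` in
`ArchGroupGLCartan`. The structure `RealMatrixGroup` only asks `exp 𝔤 ⊆ G` and allows infinitely
many components, so the property has to be assumed where needed. The binder
`(G : RealMatrixGroup A N)` is explicit: this is a predicate, used as
`(hG : G.HasCartanDecomposition)`. [folklore] -/
def HasCartanDecomposition (G : RealMatrixGroup A N) : Prop :=
  ∀ g ∈ G.carrier, ∃ k ∈ G.maximalCompact, ∃ X ∈ G.lie,
    IsSelfAdjoint X ∧ g = k * expGL X

/-- `K = G ∩ U(N, A)` is compact, for `A` a finite-dimensional star-formally-real commutative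
real `*`-algebra (e.g. `ℝ`, `ℂ`, `K ⊗_ℚ ℝ`). Knapp, I.§1; Borel–Jacquet §1.1. [folklore] -/
def isCompact_maximalCompact : Prop :=
  ∀ [FiniteDimensional ℝ A] (hA : IsStarFormallyReal A),
    IsCompact (G.maximalCompact : Set (GL N A))

/- interim proof relied on results that are now named facts (D-0014); demoted to a fact by the M5 import, proof preserved:
:=
  G.isCompact_maximalCompact_of_isCompact (isCompact_unitarySubgroupGL hA)
-/

/-- `K = G ∩ U(N, A)` is a *maximal* compact subgroup of `G`: any compact subgroup `K'` of `G`
containing `K` equals `K` (for `A ≅ ℝ^r × ℂ^s` standard and `G` admitting the global Cartan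
decomposition; then `exp X ∈ K'` with `X` hermitian has bounded powers, forcing `X = 0`).
Cartan–Malcev–Iwasawa; Knapp, VI.§2, Thm. 6.31(g) and VII.§2, Prop. 7.19(a). [cite: Knapp2002, Thm. 6.31(g) and Prop. 7.19(a)] -/
def isMaximalCompact_maximalCompact : Prop :=
  ∀ [FiniteDimensional ℝ A] (hA : IsStarFormallyReal A) (hG : G.HasCartanDecomposition) (K' : Subgroup (GL N A)) (hK'G : K' ≤ G.carrier) (hKK' : G.maximalCompact ≤ K') (hK' : IsCompact (K' : Set (GL N A))),
    K' = G.maximalCompact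

end Compact

end RealMatrixGroup

end RealMatrixGroup

end Literature.NumberTheory.Automorphic
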